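import Summits.CriticalPhenomena.PercolationContinuityZ3.Theorems.PercNearOneGluingNoHeavyPcintOSMSiteAssembly
import Literature.Probability.Percolation.HypercubicAxisGroupingSite
import HarnessLib

/-!
# PCINT lane, PHASE 4 (kernel second-moment oriented route, sites): the cell `p_c^site(ℤ^7) ≤ 0.1749`

Cell `prim-pcint`, seat `prim-pcint-1` (gen 13); memo `run/shared/lean/prim/pcint/T-FIBRE-ROUTE.md` §PHASE 4.

The site analogue of the Cox–Durrett second-moment bound (`OSM.siteCriticalProb_le_of_green`):
`p_c^site(ℤ^7) ≤ 1 − 1/G⁺` with the kernel-certified Green's-function bound `G⁺ = OSM.GplusQ 7 15` (exact partial sum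
`Σ_{k<105} u_k` by the row recursion `OSM.vrow` + the closed-form tail, `OSM.sum_u_le_Gplus`), checked by `decide +kernel` in
exact rational arithmetic (`OSM.checkOSMsite`).  UNCONDITIONAL; below the lane's PHASE-2 fibre cell for `d = 7`.
-/

noncomputable section

namespace Summit.CriticalPhenomena.PercolationContinuityZ3.Theorems.Pcint.OSM

open Literature.Probability.Percolation Literature.Probability.LatticeModels

/-- **The kernel check for site `ℤ^7`**: `GplusQ 7 15 · (10⁴ − 1749) ≤ 10⁴` in exact rational arithmetic. -/
theorem checkOSMsite_7 : checkOSMsite 7 15 1749 = true := by decide +kernel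

/-- **`p_c^site(ℤ^7) ≤ 0.1749`** (second-moment oriented route, sites). -/
theorem siteCriticalProb_Z7_le_1749 : siteCriticalProb (zdGraph 7) (0 : Site 7) ≤ 0.1749 :=
  (siteCriticalProb_le_of_checkOSMsite (by norm_num) (by norm_num) (by norm_num) checkOSMsite_7).trans (by norm_num)

/-- **`p_c^site(ℤ^d) ≤ 0.1749` for every `d ≥ 7`.** -/
theorem siteCriticalProb_zd_le_1749 {d : ℕ} (hd : 7 ≤ d) : siteCriticalProb (zdGraph d) (0 : Site d) ≤ 0.1749 :=
  (AxisGrouping.siteCriticalProb_zd_anti hd).trans siteCriticalProb_Z7_le_1749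

end Summit.CriticalPhenomena.PercolationContinuityZ3.Theorems.Pcint.OSM

end
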